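import Literature.GroupTheory.CombinatorialGroupTheory.CyclicBlockInterchangeTransport
import HarnessLib

/-!
# A cyclic block interchange that gains two orbits (Heuer 2020, Lemmas 3.5 and 3.7)

Sequel of `CyclicBlockInterchangeTransport.lean`. For a letter matching `p` of `v` against `w`
with `α = σπ`, `α² ≠ 1`, [Heuer2020, Lemma 3.5] finds cyclically ordered cut points on the
`v`-circle in special position with respect to the orbits of `α`, and [Heuer2020, Lemma 3.7]
shows that the corresponding block interchange `γ` has `orb(α_γ) = orb(α) + 2`. Iterating
([Heuer2020, Claim 3.9 and proof of Thm. 2 (i), §3.2.4]) gives the upper bound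
`d_cbi(v, w) ≤ (n − orb(σπ))/2` for EVERY matching, which together with the lower bound of the
prequel is the orbit-counting formula for the cyclic block interchange distance,

  `2 · d_cbi(v, w) = n − max_π orb(σπ)`        (`CBI.two_mul_dcbi_eq`),

i.e. [Heuer2020, Thm. 2 (i)] `d_cbi(v,w) = cl(v + w⁻¹)` read through Bardakov's formula for the
chain `v + w⁻¹` (`cl(v + w⁻¹) = min_π (n − orb(σπ))/2`, loc. cit. §3.2).

Contents: the permutation `τ = α²|_{I⁺}` of the `v`-circle (`CBI.tauP`); arc and other-cycle
lemmas for `swap x y * f`; Lemma 3.5 (`CBI.exists_config`, with the printed selection rule: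
`i₀` minimises the forward distance `|α²(x) − x|`, `i₁ = i₀ + K` is the first non-fixed point of
`α²` after `i₀`, `i₂ = α²(i₀)`, `i₃ = α²(i₁)`; the printed auxiliary Claim 3.6 "`K < M − 1`" is
not needed — and not true in general — and is replaced by the direct verification that `i₃` does
not lie cyclically in `[i₀, i₂]`); Lemma 3.7 / Claim 3.8 (`CBI.rho_blockPerm_three`,
`CBI.rho_blockPerm_four`: `ρ` is the 3-cycle `(0 i₁ i₂)` resp. the double transposition
`(0 i₂)(i₁ i₃)`, and `orb` goes up by exactly two); the key step `CBI.exists_isCBI_ncyc_add_two`;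
the induction `CBI.two_mul_dcbi_add_ncyc_le`; the formula `CBI.two_mul_dcbi_eq`.

Everything here is proved; no named facts.

## References

* [Heuer2020] N. Heuer, *Computing commutator length is hard*, arXiv:2001.10230, §3.2.2
  (Lemma 3.5, Claim 3.6), §3.2.3 (Lemma 3.7, Claim 3.8), §3.2.4 (Claims 3.9, 3.10, Thm. 2 (i)).
-/

namespace Literature.GroupTheory.CombinatorialGroupTheory

open Equiv Equiv.Perm

/-! ### Cycles of `swap x y * f`: the arc from `x`, and untouched cycles -/

namespace Bardakov

variable {β : Type*} [DecidableEq β]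

/-- **Arc lemma**: as long as the iterates `f x, f² x, …, fᵏ x` avoid `x` and `y`, the
permutation `swap x y * f` follows `f` from `x`. [folklore] -/
theorem swap_mul_pow_apply_eq {f : Perm β} {x y : β} {k : ℕ}
    (h : ∀ j, 1 ≤ j → j ≤ k → (f ^ j) x ≠ x ∧ (f ^ j) x ≠ y) :
    ∀ j, j ≤ k → ((swap x y * f) ^ j) x = (f ^ j) x
  | 0, _ => by simp
  | j + 1, hj => by
    rw [pow_succ', Perm.mul_apply, swap_mul_pow_apply_eq h j (Nat.le_of_succ_le hj), pow_succ', Perm.mul_apply,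
      Perm.mul_apply]
    obtain ⟨h1, h2⟩ := h (j + 1) (Nat.succ_le_succ (Nat.zero_le j)) hj
    rw [pow_succ', Perm.mul_apply] at h1 h2
    exact swap_apply_of_ne_of_ne h1 h2

/-- Hence such an iterate lies on the cycle of `x` for `swap x y * f`. [folklore] -/
theorem sameCycle_swap_mul_of_arc {f : Perm β} {x y : β} {k : ℕ}
    (h : ∀ j, 1 ≤ j → j ≤ k → (f ^ j) x ≠ x ∧ (f ^ j) x ≠ y) :
    (swap x y * f).SameCycle x ((f ^ k) x) :=
  ⟨k, by rw [zpow_natCast, swap_mul_pow_apply_eq h k le_rfl]⟩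

/-- **Untouched cycles**: on a cycle of `f` avoiding `x` and `y`, `swap x y * f` is `f`. [folklore] -/
theorem swap_mul_pow_apply_of_not_sameCycle {f : Perm β} {x y a : β} (hx : ¬ f.SameCycle a x)
    (hy : ¬ f.SameCycle a y) : ∀ j : ℕ, ((swap x y * f) ^ j) a = (f ^ j) a
  | 0 => by simp
  | j + 1 => by
    rw [pow_succ', Perm.mul_apply, swap_mul_pow_apply_of_not_sameCycle hx hy j, pow_succ', Perm.mul_apply,
      Perm.mul_apply]
    refine swap_apply_of_ne_of_ne (fun h => hx ⟨(j + 1 : ℕ), ?_⟩) (fun h => hy ⟨(j + 1 : ℕ), ?_⟩)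
    · rw [zpow_natCast, pow_succ', Perm.mul_apply, h]
    · rw [zpow_natCast, pow_succ', Perm.mul_apply, h]

/-- Hence a cycle avoiding `x, y` stays a cycle: `SameCycle` is preserved on it. [folklore] -/
theorem sameCycle_swap_mul_of_not_sameCycle [Finite β] {f : Perm β} {x y a b : β} (hx : ¬ f.SameCycle a x)
    (hy : ¬ f.SameCycle a y) (hab : f.SameCycle a b) : (swap x y * f).SameCycle a b := by
  obtain ⟨j, -, rfl⟩ := hab.exists_pow_eq'
  exact ⟨j, by rw [zpow_natCast, swap_mul_pow_apply_of_not_sameCycle hx hy j]⟩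

end Bardakov

namespace CBI

open Bardakov

variable {n : ℕ}

/-! ### The permutation `τ = α²|_{I⁺}` of the `v`-circle -/

/-- `τ(x) = σ π⁻¹ σ⁻¹ π (x)` on `I⁺`, i.e. `α²` restricted to the `v`-circle:
`τ x = p⁻¹(p x − 1) + 1`. [cite: Heuer2020, Lemma 3.5] -/
def tauP (p : Perm (Fin n)) : Perm (Fin n) :=
  finRotate n * p⁻¹ * (finRotate n)⁻¹ * p

/-- Value of `τ`. [cite: Heuer2020, Lemma 3.5] -/
theorem tauP_apply (p : Perm (Fin n)) (x : Fin n) : tauP p x = finRotate n (p.symm ((finRotate n).symm (p x))) := rfl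

/-- `α²(x⁺) = (τ x)⁺`. [cite: Heuer2020, Lemma 3.5] -/
theorem alpha_alpha_inl_eq (p : Perm (Fin n)) (x : Fin n) :
    alpha p (alpha p (Sum.inl x)) = Sum.inl (tauP p x) := rfl

/-- Even powers of `α` on `I⁺` are powers of `τ`. [folklore] -/
theorem alpha_pow_two_mul_inl (p : Perm (Fin n)) (j : ℕ) (x : Fin n) :
    (alpha p ^ (2 * j)) (Sum.inl x) = Sum.inl ((tauP p ^ j) x) := by
  induction j generalizing x with
  | zero => simp
  | succ j ih =>
    rw [Nat.mul_succ, pow_add, Perm.mul_apply, pow_two, Perm.mul_apply, alpha_alpha_inl_eq, ih, pow_succ,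
      Perm.mul_apply]

/-- Odd powers of `α` map `I⁺` into `I⁻`. [folklore] -/
theorem alpha_pow_two_mul_succ_inl (p : Perm (Fin n)) (j : ℕ) (x : Fin n) :
    (alpha p ^ (2 * j + 1)) (Sum.inl x) = Sum.inr ((finRotate n).symm (p ((tauP p ^ j) x))) := by
  rw [pow_succ', Perm.mul_apply, alpha_pow_two_mul_inl, alpha_inl]

/-- **Orbits of `α` on `I⁺` are the orbits of `τ`.** [cite: Heuer2020, §3.2.1] -/
theorem sameCycle_inl_iff (p : Perm (Fin n)) (x y : Fin n) :
    (alpha p).SameCycle (Sum.inl x) (Sum.inl y) ↔ (tauP p).SameCycle x y := by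
  constructor
  · intro h
    obtain ⟨j, -, hj⟩ := h.exists_pow_eq'
    obtain ⟨i, rfl | rfl⟩ := Nat.even_or_odd' j
    · rw [alpha_pow_two_mul_inl, Sum.inl.injEq] at hj
      exact ⟨i, by rw [zpow_natCast, hj]⟩
    · rw [alpha_pow_two_mul_succ_inl] at hj
      cases hj
  · intro h
    obtain ⟨j, -, hj⟩ := h.exists_pow_eq'
    exact ⟨(2 * j : ℕ), by rw [zpow_natCast, alpha_pow_two_mul_inl, hj]⟩

/-- `τ = 1` iff `α² = 1`. [cite: Heuer2020, Lemma 3.5] -/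
theorem tauP_eq_one_iff (p : Perm (Fin n)) : tauP p = 1 ↔ alpha p ^ 2 = 1 := by
  constructor
  · intro h
    rw [pow_two]
    refine Equiv.ext fun z => ?_
    rcases z with x | j
    · rw [Perm.mul_apply, alpha_alpha_inl_eq, h, Perm.one_apply, Perm.one_apply]
    · -- `j⁻ = α(x⁺)` for `x = σ p⁻¹ j`; then `α²(j⁻) = α(α²(x⁺)) = α(x⁺) = j⁻`
      have hx : Sum.inr j = alpha p (Sum.inl (p.symm (finRotate n j))) := by
        rw [alpha_inl, Equiv.apply_symm_apply, Equiv.symm_apply_apply]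
      rw [Perm.one_apply, hx, Perm.mul_apply, alpha_alpha_inl_eq, h, Perm.one_apply]
  · intro h
    refine Equiv.ext fun x => ?_
    have := Equiv.ext_iff.1 h (Sum.inl x)
    rw [pow_two, Perm.mul_apply, alpha_alpha_inl_eq, Perm.one_apply, Sum.inl.injEq] at this
    rw [this, Perm.one_apply]

/-- Fixed points of `τ` are the preserved adjacencies: `τ x = x ↔ p x = p(x − 1) + 1`. [cite: Heuer2020, Claim 3.6] -/
theorem tauP_apply_eq_self_iff (p : Perm (Fin n)) (x : Fin n) :
    tauP p x = x ↔ p x = finRotate n (p ((finRotate n).symm x)) := by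
  rw [tauP_apply]
  constructor
  · intro h
    rw [Equiv.apply_eq_iff_eq_symm_apply, Equiv.symm_apply_eq, Equiv.symm_apply_eq] at h
    exact h
  · intro h
    rw [h, Equiv.symm_apply_apply, Equiv.symm_apply_apply, Equiv.apply_symm_apply]

/-- `τ x₀ = y ↔ p (y − 1) = p(x₀) − 1`. [cite: Heuer2020, Claim 3.6] -/
theorem tauP_apply_eq_iff (p : Perm (Fin n)) (x y : Fin n) :
    tauP p x = y ↔ p ((finRotate n).symm y) = (finRotate n).symm (p x) := by
  rw [tauP_apply]
  constructor
  · intro h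
    rw [← h, Equiv.symm_apply_apply, Equiv.apply_symm_apply]
  · intro h
    rw [← h, Equiv.symm_apply_apply, Equiv.apply_symm_apply]

/-- `τ` of a rotated matching is the conjugate: `τ_{p σᵏ} = σ⁻ᵏ τ_p σᵏ`. [folklore] -/
theorem tauP_mul_pow (p : Perm (Fin n)) (k : ℕ) :
    tauP (p * finRotate n ^ k) = (finRotate n ^ k)⁻¹ * tauP p * finRotate n ^ k := by
  unfold tauP
  have hc : Commute (finRotate n) ((finRotate n ^ k)⁻¹) := (Commute.self_pow (finRotate n) k).inv_right
  have hc' : Commute (finRotate n)⁻¹ ((finRotate n ^ k)⁻¹) := hc.inv_left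
  rw [mul_inv_rev]
  calc finRotate n * ((finRotate n ^ k)⁻¹ * p⁻¹) * (finRotate n)⁻¹ * (p * finRotate n ^ k)
      = (finRotate n * (finRotate n ^ k)⁻¹) * p⁻¹ * (finRotate n)⁻¹ * p * finRotate n ^ k := by group
    _ = ((finRotate n ^ k)⁻¹ * finRotate n) * p⁻¹ * (finRotate n)⁻¹ * p * finRotate n ^ k := by rw [hc.eq]
    _ = (finRotate n ^ k)⁻¹ * (finRotate n * p⁻¹ * (finRotate n)⁻¹ * p) * finRotate n ^ k := by group

/-! ### Lemma 3.5: special points of `α` when `α² ≠ 1` -/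

section Lemma35

open Fin.NatCast Fin.CommRing

variable [NeZero n]

/-- Powers of the rotation are translations: `σᵏ i = i + k`. [folklore] -/
theorem finRotate_pow_apply (k : ℕ) (i : Fin n) : (finRotate n ^ k) i = i + (k : Fin n) := by
  induction k with
  | zero => simp
  | succ k ih => rw [pow_succ', Perm.mul_apply, ih, finRotate_apply, Nat.cast_succ, add_assoc]

/-- `τ x = x ↔ p x = p (x − 1) + 1` (the adjacency `x − 1, x` of `v` is kept in `w`). [cite: Heuer2020, Claim 3.6] -/
theorem tauP_eq_self_iff' (p : Perm (Fin n)) (x : Fin n) : tauP p x = x ↔ p x = p (x - 1) + 1 := by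
  rw [tauP_apply_eq_self_iff, finRotate_apply, finRotate_symm_apply]

/-- `τ x = y ↔ p (y − 1) = p x − 1`. [cite: Heuer2020, Claim 3.6] -/
theorem tauP_eq_iff' (p : Perm (Fin n)) (x y : Fin n) : tauP p x = y ↔ p (y - 1) = p x - 1 := by
  rw [tauP_apply_eq_iff, finRotate_symm_apply, finRotate_symm_apply]

/-- **The run**: if `τ` fixes `x₀ + 1, …, x₀ + (K − 1)` then `p (x₀ + k) = p x₀ + k` for `k < K`
("inductively we see that `π(i₀ + k) = π(i₀) + k`"). [cite: Heuer2020, Claim 3.6] -/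
theorem apply_add_eq_of_run (p : Perm (Fin n)) (x₀ : Fin n) {K : ℕ}
    (h : ∀ k : ℕ, 1 ≤ k → k < K → tauP p (x₀ + (k : Fin n)) = x₀ + (k : Fin n)) :
    ∀ k : ℕ, k < K → p (x₀ + (k : Fin n)) = p x₀ + (k : Fin n)
  | 0, _ => by simp
  | k + 1, hk => by
    have h1 := (tauP_eq_self_iff' p _).1 (h (k + 1) (Nat.le_add_left 1 k) hk)
    have e : x₀ + ((k + 1 : ℕ) : Fin n) - 1 = x₀ + ((k : ℕ) : Fin n) := by push_cast; ring
    rw [h1, e, apply_add_eq_of_run p x₀ h k (Nat.lt_of_succ_lt hk), Nat.cast_succ, add_assoc]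

/-- Casts of small naturals are injective. [folklore] -/
theorem natCast_injOn {a b : ℕ} (ha : a < n) (hb : b < n) (h : (a : Fin n) = (b : Fin n)) : a = b := by
  have := congrArg Fin.val h
  rwa [Fin.val_cast_of_lt ha, Fin.val_cast_of_lt hb] at this

/-- The forward distance `|τ x − x| ∈ {0, …, n − 1}` along the circle. [cite: Heuer2020, Lemma 3.5] -/
def fdist (τ : Perm (Fin n)) (x : Fin n) : ℕ := (τ x - x).val

/-- `τ x = x + |τ x − x|`. [cite: Heuer2020, Lemma 3.5] -/
theorem eq_add_fdist (τ : Perm (Fin n)) (x : Fin n) : τ x = x + ((fdist τ x : ℕ) : Fin n) := by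
  rw [fdist, Fin.cast_val_eq_self]; ring

/-- A moved point has positive forward distance. [folklore] -/
theorem fdist_pos {τ : Perm (Fin n)} {x : Fin n} (h : τ x ≠ x) : 0 < fdist τ x := by
  rw [Nat.pos_iff_ne_zero]
  intro h0
  apply h
  have : τ x - x = 0 := Fin.ext (by rw [Fin.val_zero]; exact h0)
  rw [eq_add_fdist τ x, h0, Nat.cast_zero, add_zero]

/-- The offset of `y` from `x₀`: `y = x₀ + |y − x₀|`. [folklore] -/
theorem eq_add_val_sub (x₀ y : Fin n) : y = x₀ + (((y - x₀).val : ℕ) : Fin n) := by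
  rw [Fin.cast_val_eq_self]; ring

/-- **Lemma 3.5 (special points).** If `τ ≠ 1` there are a base point `x₀` and `0 < K < M < n`
with `τ x₀ = x₀ + M` (`M` minimal among all moved points, `x₀ + K` the first point after `x₀`
not fixed by `τ`) such that EITHER `x₀ + K` lies on the `τ`-cycle of `x₀` (case (A): the
cyclically ordered triple `(x₀, x₀+K, x₀+M)` visited by `τ` in the order `x₀, x₀+M, …, x₀+K`), OR
`τ (x₀ + K) = x₀ + L` with `M < L < n` and `x₀ + K` on another cycle (case (B): the cyclically
ordered quadruple `(x₀, x₀+K, x₀+M, x₀+L)`). The printed Claim 3.6 (`K < M − 1`) is replaced by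
the direct verification that `L ∉ [0, M]`. [cite: Heuer2020, Lemma 3.5] -/
theorem exists_config (p : Perm (Fin n)) (hτ : tauP p ≠ 1) :
    ∃ (x₀ : Fin n) (K M : ℕ), 0 < K ∧ K < M ∧ M < n ∧ tauP p x₀ = x₀ + ((M : ℕ) : Fin n) ∧
      ((tauP p).SameCycle x₀ (x₀ + ((K : ℕ) : Fin n)) ∨
       ∃ L : ℕ, M < L ∧ L < n ∧ tauP p (x₀ + ((K : ℕ) : Fin n)) = x₀ + ((L : ℕ) : Fin n) ∧ ¬ (tauP p).SameCycle x₀ (x₀ + ((K : ℕ) : Fin n))) := by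
  classical
  set τ := tauP p with hτdef
  have hS : (Finset.univ.filter fun x : Fin n => τ x ≠ x).Nonempty := by
    by_contra h
    rw [Finset.not_nonempty_iff_eq_empty, Finset.filter_eq_empty_iff] at h
    exact hτ (Equiv.ext fun x => by simpa using h (Finset.mem_univ x))
  obtain ⟨x₀, hx₀, hmin⟩ := Finset.exists_min_image _ (fdist τ) hS
  rw [Finset.mem_filter] at hx₀
  have hM0 : 0 < fdist τ x₀ := fdist_pos hx₀.2
  have hMn : fdist τ x₀ < n := Fin.isLt _
  have hτx₀ : τ x₀ = x₀ + ((fdist τ x₀ : ℕ) : Fin n) := eq_add_fdist τ x₀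
  set M := fdist τ x₀ with hMdef
  -- some point among `x₀ + 1, …, x₀ + (M-1)` is moved by `τ`
  have hex : ∃ k : ℕ, 1 ≤ k ∧ k ≤ M - 1 ∧ τ (x₀ + ((k : ℕ) : Fin n)) ≠ x₀ + ((k : ℕ) : Fin n) := by
    by_contra hall
    push Not at hall
    have hrun := apply_add_eq_of_run p x₀ (K := M) (fun k h1 h2 => hall k h1 (by omega))
    have h1 : p (x₀ + ((M - 1 : ℕ) : Fin n)) = p x₀ + ((M - 1 : ℕ) : Fin n) := hrun (M - 1) (by omega)
    have h2 : p (x₀ + ((M : ℕ) : Fin n) - 1) = p x₀ - 1 := (tauP_eq_iff' p x₀ (x₀ + ((M : ℕ) : Fin n))).1 hτx₀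
    have e : x₀ + ((M : ℕ) : Fin n) - 1 = x₀ + ((M - 1 : ℕ) : Fin n) := by
      rw [Nat.cast_pred hM0]; ring
    rw [e, h1] at h2
    have h3 : ((M : ℕ) : Fin n) = 0 := by
      calc ((M : ℕ) : Fin n) = ((M - 1 : ℕ) : Fin n) + 1 := by rw [Nat.cast_pred hM0]; ring
        _ = (p x₀ + ((M - 1 : ℕ) : Fin n)) - p x₀ + 1 := by ring
        _ = (p x₀ - 1) - p x₀ + 1 := by rw [h2]
        _ = 0 := by ring
    rw [Fin.natCast_eq_zero] at h3
    exact absurd (Nat.le_of_dvd hM0 h3) (by omega)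
  obtain ⟨hK1, hKM, hKne⟩ := Nat.find_spec hex
  set K := Nat.find hex with hKdef
  have hKmin : ∀ k : ℕ, 1 ≤ k → k < K → τ (x₀ + ((k : ℕ) : Fin n)) = x₀ + ((k : ℕ) : Fin n) := fun k h1 h2 => by
    by_contra hne
    exact Nat.find_min hex h2 ⟨h1, by omega, hne⟩
  have hrun := apply_add_eq_of_run p x₀ hKmin
  refine ⟨x₀, K, M, hK1, by omega, hMn, hτx₀, ?_⟩
  by_cases hsc : τ.SameCycle x₀ (x₀ + ((K : ℕ) : Fin n))
  · exact Or.inl hsc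
  · right
    have hL : τ (x₀ + ((K : ℕ) : Fin n)) = x₀ + (((τ (x₀ + ((K : ℕ) : Fin n)) - x₀).val : ℕ) : Fin n) := eq_add_val_sub x₀ _
    set L := (τ (x₀ + ((K : ℕ) : Fin n)) - x₀).val with hLdef
    have hLn : L < n := Fin.isLt _
    refine ⟨L, ?_, hLn, hL, hsc⟩
    by_contra hle
    push Not at hle
    -- `L ∉ [0, M]`: four sub-cases
    rcases Nat.eq_zero_or_pos L with hL0 | hLpos
    · -- `L = 0`: `τ (x₀ + K) = x₀`, same cycle
      apply hsc
      rw [hL0, Nat.cast_zero, add_zero] at hL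
      exact SameCycle.symm (⟨1, by rw [zpow_one, hL]⟩ : τ.SameCycle (x₀ + ((K : ℕ) : Fin n)) x₀)
    rcases Nat.lt_or_ge M L with hML | hLM
    · exact absurd hML (not_lt.2 hle)
    rcases Nat.lt_or_ge K L with hKL | hLK
    · rcases Nat.lt_or_ge L M with hLM' | hML'
      · -- `K < L < M`: the forward distance of `x₀ + K` is `L − K < M`, contradicting minimality
        have hd : fdist τ (x₀ + ((K : ℕ) : Fin n)) = L - K := by
          unfold fdist
          rw [hL, show x₀ + ((L : ℕ) : Fin n) - (x₀ + ((K : ℕ) : Fin n)) = ((L - K : ℕ) : Fin n) by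
            rw [Nat.cast_sub hKL.le]; ring, Fin.val_cast_of_lt (by omega)]
        have := hmin (x₀ + ((K : ℕ) : Fin n)) (Finset.mem_filter.2 ⟨Finset.mem_univ _, hKne⟩)
        omega
      · -- `L = M`: `τ (x₀ + K) = τ x₀`
        have hLM2 : L = M := le_antisymm hle hML'
        have h1 : x₀ + ((K : ℕ) : Fin n) = x₀ := τ.injective (by rw [hL, hLM2, ← hτx₀])
        have h2 : ((K : ℕ) : Fin n) = 0 := by
          calc ((K : ℕ) : Fin n) = x₀ + ((K : ℕ) : Fin n) - x₀ := by ring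
            _ = 0 := by rw [h1, sub_self]
        rw [Fin.natCast_eq_zero] at h2
        exact absurd (Nat.le_of_dvd hK1 h2) (by omega)
    · -- `1 ≤ L ≤ K`: compare `p (x₀ + K)` with the run
      have h2 : p (x₀ + ((L : ℕ) : Fin n) - 1) = p (x₀ + ((K : ℕ) : Fin n)) - 1 := (tauP_eq_iff' p _ _).1 hL
      have e : x₀ + ((L : ℕ) : Fin n) - 1 = x₀ + ((L - 1 : ℕ) : Fin n) := by
        rw [Nat.cast_pred hLpos]; ring
      rw [e, hrun (L - 1) (by omega)] at h2
      have h3 : p (x₀ + ((K : ℕ) : Fin n)) = p x₀ + ((L : ℕ) : Fin n) := by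
        calc p (x₀ + ((K : ℕ) : Fin n)) = (p (x₀ + ((K : ℕ) : Fin n)) - 1) + 1 := by ring
          _ = p x₀ + ((L - 1 : ℕ) : Fin n) + 1 := by rw [← h2]
          _ = p x₀ + ((L : ℕ) : Fin n) := by rw [Nat.cast_pred hLpos]; ring
      rcases Nat.lt_or_ge L K with hLK' | hKL'
      · -- `L < K`: `p (x₀ + K) = p (x₀ + L)`
        rw [← hrun L hLK'] at h3
        have h4 := p.injective h3
        have h5 : ((K : ℕ) : Fin n) = ((L : ℕ) : Fin n) := by
          calc ((K : ℕ) : Fin n) = x₀ + ((K : ℕ) : Fin n) - x₀ := by ring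
            _ = ((L : ℕ) : Fin n) := by rw [h4]; ring
        have := natCast_injOn (by omega) hLn h5
        omega
      · -- `L = K`: then `τ` fixes `x₀ + K`
        have hLK2 : L = K := le_antisymm hLK hKL'
        apply hKne
        rw [tauP_eq_self_iff']
        rw [hLK2] at h3
        rw [h3, show x₀ + ((K : ℕ) : Fin n) - 1 = x₀ + ((K - 1 : ℕ) : Fin n) by rw [Nat.cast_pred hK1]; ring,
          hrun (K - 1) (by omega), Nat.cast_pred hK1]
        ring

end Lemma35

/-! ### Claim 3.8 made explicit: `ρ` of a block interchange is a 3-cycle or a double transposition -/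

section Rho

/-- `σ` on position values. [folklore] -/
def rotN (n t : ℕ) : ℕ := if t + 1 = n then 0 else t + 1

/-- `σ⁻¹` on position values. [folklore] -/
def rotInvN (n t : ℕ) : ℕ := if t = 0 then n - 1 else t - 1

/-- `σ⁻¹(0) = n - 1`. [folklore] -/
theorem rotInvN_zero (n : ℕ) : rotInvN n 0 = n - 1 := if_pos rfl

/-- `σ⁻¹(t) = t - 1` for `t ≠ 0`. [folklore] -/
theorem rotInvN_of_ne_zero {n t : ℕ} (h : t ≠ 0) : rotInvN n t = t - 1 := if_neg h

/-- `σ(t) = t + 1` below the top. [folklore] -/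
theorem rotN_of_lt {n t : ℕ} (h : t + 1 < n) : rotN n t = t + 1 := if_neg (Nat.ne_of_lt h)

/-- `σ(n - 1) = 0`. [folklore] -/
theorem rotN_of_eq {n t : ℕ} (h : t + 1 = n) : rotN n t = 0 := if_pos h

/-- The block map on `w₁`. [folklore] -/
theorem blockFun_of_lt₁ {a b c d x : ℕ} (h : x < a) : blockFun a b c d x = x := by
  unfold blockFun; rw [if_pos h]

/-- The block map on `w₂`. [folklore] -/
theorem blockFun_of_lt₂ {a b c d x : ℕ} (h₁ : a ≤ x) (h₂ : x < a + b) : blockFun a b c d x = x + c + d := by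
  unfold blockFun; rw [if_neg (by omega), if_pos h₂]

/-- The block map on `w₃`. [folklore] -/
theorem blockFun_of_lt₃ {a b c d x : ℕ} (h₁ : a + b ≤ x) (h₂ : x < a + b + c) : blockFun a b c d x = x + d - b := by
  unfold blockFun; rw [if_neg (by omega), if_neg (by omega), if_pos h₂]

/-- The block map on `w₄`. [folklore] -/
theorem blockFun_of_le₄ {a b c d x : ℕ} (h : a + b + c ≤ x) : blockFun a b c d x = x - (b + c) := by
  unfold blockFun; rw [if_neg (by omega), if_neg (by omega), if_neg (by omega)]

/-- The inverse block map on the first new block. [folklore] -/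
theorem blockInv_of_lt₁ {a b c d y : ℕ} (h : y < a) : blockInv a b c d y = y := by
  unfold blockInv; rw [if_pos h]

/-- The inverse block map on the second new block. [folklore] -/
theorem blockInv_of_lt₂ {a b c d y : ℕ} (h₁ : a ≤ y) (h₂ : y < a + d) : blockInv a b c d y = y + b + c := by
  unfold blockInv; rw [if_neg (by omega), if_pos h₂]

/-- The inverse block map on the third new block. [folklore] -/
theorem blockInv_of_lt₃ {a b c d y : ℕ} (h₁ : a + d ≤ y) (h₂ : y < a + d + c) : blockInv a b c d y = y + b - d := by
  unfold blockInv; rw [if_neg (by omega), if_neg (by omega), if_pos h₂]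

/-- The inverse block map on the fourth new block. [folklore] -/
theorem blockInv_of_le₄ {a b c d y : ℕ} (h : a + d + c ≤ y) : blockInv a b c d y = y - (c + d) := by
  unfold blockInv; rw [if_neg (by omega), if_neg (by omega), if_neg (by omega)]

/-- `ρ(0⁺) = i₂⁺` (four non-empty blocks), by value. [cite: Heuer2020, Claim 3.8] -/
theorem rhoVal_four_zero {a b c d n : ℕ} (hn : n = a + b + c + d) (ha : 1 ≤ a) (hb : 1 ≤ b) (hc : 1 ≤ c) (hd : 1 ≤ d) :
    blockInv a b c d (rotN n (blockFun a b c d (rotInvN n 0))) = a + b := by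
  rw [rotInvN_zero, blockFun_of_le₄ (by omega), rotN_of_lt (by omega), blockInv_of_lt₃ (by omega) (by omega)]; omega

/-- `ρ(i₁⁺) = i₃⁺` (four non-empty blocks), by value. [cite: Heuer2020, Claim 3.8] -/
theorem rhoVal_four_a {a b c d n : ℕ} (hn : n = a + b + c + d) (ha : 1 ≤ a) (hb : 1 ≤ b) (hc : 1 ≤ c) (hd : 1 ≤ d) :
    blockInv a b c d (rotN n (blockFun a b c d (rotInvN n a))) = a + b + c := by
  rw [rotInvN_of_ne_zero (by omega), blockFun_of_lt₁ (by omega), rotN_of_lt (by omega),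
    blockInv_of_lt₂ (by omega) (by omega)]; omega

/-- `ρ(i₂⁺) = 0⁺` (four non-empty blocks), by value. [cite: Heuer2020, Claim 3.8] -/
theorem rhoVal_four_ab {a b c d n : ℕ} (hn : n = a + b + c + d) (ha : 1 ≤ a) (hb : 1 ≤ b) :
    blockInv a b c d (rotN n (blockFun a b c d (rotInvN n (a + b)))) = 0 := by
  rw [rotInvN_of_ne_zero (by omega), blockFun_of_lt₂ (by omega) (by omega), rotN_of_eq (by omega),
    blockInv_of_lt₁ (by omega)]

/-- `ρ(i₃⁺) = i₁⁺` (four non-empty blocks), by value. [cite: Heuer2020, Claim 3.8] -/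
theorem rhoVal_four_abc {a b c d n : ℕ} (hn : n = a + b + c + d) (ha : 1 ≤ a) (hb : 1 ≤ b) (hc : 1 ≤ c) (hd : 1 ≤ d) :
    blockInv a b c d (rotN n (blockFun a b c d (rotInvN n (a + b + c)))) = a := by
  rw [rotInvN_of_ne_zero (by omega), blockFun_of_lt₃ (by omega) (by omega), rotN_of_lt (by omega),
    blockInv_of_le₄ (by omega)]; omega

/-- `ρ(0⁺) = i₁⁺` (three blocks), by value. [cite: Heuer2020, Claim 3.8] -/
theorem rhoVal_three_zero {a b d n : ℕ} (hn : n = a + b + 0 + d) (ha : 1 ≤ a) (hb : 1 ≤ b) (hd : 1 ≤ d) :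
    blockInv a b 0 d (rotN n (blockFun a b 0 d (rotInvN n 0))) = a := by
  rw [rotInvN_zero, blockFun_of_le₄ (by omega), rotN_of_lt (by omega), blockInv_of_le₄ (by omega)]; omega

/-- `ρ(i₁⁺) = i₂⁺` (three blocks), by value. [cite: Heuer2020, Claim 3.8] -/
theorem rhoVal_three_a {a b d n : ℕ} (hn : n = a + b + 0 + d) (ha : 1 ≤ a) (hb : 1 ≤ b) (hd : 1 ≤ d) :
    blockInv a b 0 d (rotN n (blockFun a b 0 d (rotInvN n a))) = a + b := by
  rw [rotInvN_of_ne_zero (by omega), blockFun_of_lt₁ (by omega), rotN_of_lt (by omega),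
    blockInv_of_lt₂ (by omega) (by omega)]; omega

/-- `ρ(i₂⁺) = 0⁺` (three blocks), by value. [cite: Heuer2020, Claim 3.8] -/
theorem rhoVal_three_ab {a b d n : ℕ} (hn : n = a + b + 0 + d) (ha : 1 ≤ a) (hb : 1 ≤ b) :
    blockInv a b 0 d (rotN n (blockFun a b 0 d (rotInvN n (a + b)))) = 0 := by
  rw [rotInvN_of_ne_zero (by omega), blockFun_of_lt₂ (by omega) (by omega), rotN_of_eq (by omega),
    blockInv_of_lt₁ (by omega)]

/-- Value of `σ⁻¹`. [folklore] -/
theorem val_finRotate_symm' (x : Fin n) : ((finRotate n).symm x).val = rotInvN n x.val := by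
  have h := Bardakov.val_finRotate ((finRotate n).symm x)
  rw [Equiv.apply_symm_apply] at h
  have hlt := ((finRotate n).symm x).isLt
  unfold rotInvN
  split_ifs at h <;> split_ifs <;> omega

/-- Value of `γ⁻¹ σ γ σ⁻¹ (x)` for the block map `γ`. [cite: Heuer2020, Claim 3.8] -/
theorem val_conj_blockPerm {a b c d : ℕ} (hn : n = a + b + c + d) (x : Fin n) :
    ((blockPerm a b c d n hn)⁻¹ (finRotate n (blockPerm a b c d n hn ((finRotate n).symm x)))).val =
      blockInv a b c d (rotN n (blockFun a b c d (rotInvN n x.val))) := by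
  rw [Perm.inv_def]
  show blockInv a b c d (finRotate n (blockPerm a b c d n hn ((finRotate n).symm x))).val = _
  rw [Bardakov.val_finRotate, val_blockPerm, val_finRotate_symm']
  rfl

/-- `ρ` of the block map at a point `x⁺`, by value. [cite: Heuer2020, Claim 3.8] -/
theorem rho_blockPerm_inl_eq {a b c d : ℕ} (hn : n = a + b + c + d) (x y : Fin n)
    (h : blockInv a b c d (rotN n (blockFun a b c d (rotInvN n x.val))) = y.val) :
    rho (blockPerm a b c d n hn) (Sum.inl x) = Sum.inl y := by
  rw [rho_inl, Sum.inl.injEq]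
  exact Fin.ext (by rw [val_conj_blockPerm, h])

/-- `ρ` of the block map fixes `x⁺` off the cut points. [cite: Heuer2020, Claim 3.8] -/
theorem rho_blockPerm_inl_of_ne {a b c d : ℕ} (hn : n = a + b + c + d) (x : Fin n) (h0 : x.val ≠ 0)
    (h1 : x.val ≠ a) (h2 : x.val ≠ a + b) (h3 : x.val ≠ a + b + c) :
    rho (blockPerm a b c d n hn) (Sum.inl x) = Sum.inl x := by
  refine rho_inl_of_comm _ (blockPerm_finRotate hn _ ?_ ?_ ?_ ?_) <;> rw [Equiv.apply_symm_apply] <;> assumption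

/-- Two points `x⁺ ≠ y⁺` by value. [folklore] -/
theorem inl_ne_inl_of_val_ne {x y : Fin n} (h : x.val ≠ y.val) : (Sum.inl x : Fin n ⊕ Fin n) ≠ Sum.inl y := by
  rw [ne_eq, Sum.inl.injEq]
  exact fun e => h (congrArg Fin.val e)

/-- **Claim 3.8, four blocks**: for `γ = γ_{i₁,i₂,i₃}` (all four blocks non-empty, cut points
`0, i₁ = a, i₂ = a+b, i₃ = a+b+c`), `ρ = γ⁻¹σγσ⁻¹` is the double transposition
`(0⁺ i₂⁺)(i₁⁺ i₃⁺)`. [cite: Heuer2020, Claim 3.8] -/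
theorem rho_blockPerm_four {a b c d : ℕ} (hn : n = a + b + c + d) (ha : 1 ≤ a) (hb : 1 ≤ b) (hc : 1 ≤ c)
    (hd : 1 ≤ d) :
    rho (blockPerm a b c d n hn) =
      swap (Sum.inl (⟨0, by omega⟩ : Fin n)) (Sum.inl ⟨a + b, by omega⟩) *
        swap (Sum.inl (⟨a, by omega⟩ : Fin n)) (Sum.inl ⟨a + b + c, by omega⟩) := by
  refine Equiv.ext fun z => ?_
  rcases z with x | j
  · rw [Perm.mul_apply]
    by_cases h0 : x.val = 0
    · rw [rho_blockPerm_inl_eq hn x ⟨a + b, by omega⟩ (by rw [h0]; exact rhoVal_four_zero hn ha hb hc hd),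
        swap_apply_of_ne_of_ne (inl_ne_inl_of_val_ne (by simp only [h0]; omega))
          (inl_ne_inl_of_val_ne (by simp only [h0]; omega)),
        show (Sum.inl x : Fin n ⊕ Fin n) = Sum.inl ⟨0, by omega⟩ from congrArg Sum.inl (Fin.ext h0), swap_apply_left]
    by_cases h1 : x.val = a
    · rw [rho_blockPerm_inl_eq hn x ⟨a + b + c, by omega⟩ (by rw [h1]; exact rhoVal_four_a hn ha hb hc hd),
        show (Sum.inl x : Fin n ⊕ Fin n) = Sum.inl ⟨a, by omega⟩ from congrArg Sum.inl (Fin.ext h1), swap_apply_left,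
        swap_apply_of_ne_of_ne (inl_ne_inl_of_val_ne (by simp only []; omega))
          (inl_ne_inl_of_val_ne (by simp only []; omega))]
    by_cases h2 : x.val = a + b
    · rw [rho_blockPerm_inl_eq hn x ⟨0, by omega⟩ (by rw [h2]; exact rhoVal_four_ab hn ha hb),
        swap_apply_of_ne_of_ne (inl_ne_inl_of_val_ne (by simp only [h2]; omega))
          (inl_ne_inl_of_val_ne (by simp only [h2]; omega)),
        show (Sum.inl x : Fin n ⊕ Fin n) = Sum.inl ⟨a + b, by omega⟩ from congrArg Sum.inl (Fin.ext h2),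
        swap_apply_right]
    by_cases h3 : x.val = a + b + c
    · rw [rho_blockPerm_inl_eq hn x ⟨a, by omega⟩ (by rw [h3]; exact rhoVal_four_abc hn ha hb hc hd),
        show (Sum.inl x : Fin n ⊕ Fin n) = Sum.inl ⟨a + b + c, by omega⟩ from congrArg Sum.inl (Fin.ext h3),
        swap_apply_right,
        swap_apply_of_ne_of_ne (inl_ne_inl_of_val_ne (by simp only []; omega))
          (inl_ne_inl_of_val_ne (by simp only []; omega))]
    · rw [rho_blockPerm_inl_of_ne hn x h0 h1 h2 h3,
        swap_apply_of_ne_of_ne (inl_ne_inl_of_val_ne (by simp only []; omega))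
          (inl_ne_inl_of_val_ne (by simp only []; omega)),
        swap_apply_of_ne_of_ne (inl_ne_inl_of_val_ne (by simp only []; omega))
          (inl_ne_inl_of_val_ne (by simp only []; omega))]
  · rw [rho_inr, Perm.mul_apply, swap_apply_of_ne_of_ne Sum.inr_ne_inl Sum.inr_ne_inl,
      swap_apply_of_ne_of_ne Sum.inr_ne_inl Sum.inr_ne_inl]

/-- **Claim 3.8, three blocks**: for `γ = γ_{i₁,i₂}` (`v₃ = ∅`, cut points `0, i₁ = a, i₂ = a+b`),
`ρ` is the 3-cycle `0⁺ ↦ i₁⁺ ↦ i₂⁺ ↦ 0⁺`, i.e. `(0⁺ i₂⁺)(0⁺ i₁⁺)`. [cite: Heuer2020, Claim 3.8] -/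
theorem rho_blockPerm_three {a b d : ℕ} (hn : n = a + b + 0 + d) (ha : 1 ≤ a) (hb : 1 ≤ b) (hd : 1 ≤ d) :
    rho (blockPerm a b 0 d n hn) =
      swap (Sum.inl (⟨0, by omega⟩ : Fin n)) (Sum.inl ⟨a + b, by omega⟩) *
        swap (Sum.inl (⟨0, by omega⟩ : Fin n)) (Sum.inl ⟨a, by omega⟩) := by
  refine Equiv.ext fun z => ?_
  rcases z with x | j
  · rw [Perm.mul_apply]
    by_cases h0 : x.val = 0
    · rw [rho_blockPerm_inl_eq hn x ⟨a, by omega⟩ (by rw [h0]; exact rhoVal_three_zero hn ha hb hd),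
        show (Sum.inl x : Fin n ⊕ Fin n) = Sum.inl ⟨0, by omega⟩ from congrArg Sum.inl (Fin.ext h0), swap_apply_left,
        swap_apply_of_ne_of_ne (inl_ne_inl_of_val_ne (by simp only []; omega))
          (inl_ne_inl_of_val_ne (by simp only []; omega))]
    by_cases h1 : x.val = a
    · rw [rho_blockPerm_inl_eq hn x ⟨a + b, by omega⟩ (by rw [h1]; exact rhoVal_three_a hn ha hb hd),
        show (Sum.inl x : Fin n ⊕ Fin n) = Sum.inl ⟨a, by omega⟩ from congrArg Sum.inl (Fin.ext h1), swap_apply_right,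
        swap_apply_left]
    by_cases h2 : x.val = a + b
    · rw [rho_blockPerm_inl_eq hn x ⟨0, by omega⟩ (by rw [h2]; exact rhoVal_three_ab hn ha hb),
        swap_apply_of_ne_of_ne (inl_ne_inl_of_val_ne (by simp only [h2]; omega))
          (inl_ne_inl_of_val_ne (by simp only [h2]; omega)),
        show (Sum.inl x : Fin n ⊕ Fin n) = Sum.inl ⟨a + b, by omega⟩ from congrArg Sum.inl (Fin.ext h2),
        swap_apply_right]
    · rw [rho_blockPerm_inl_of_ne hn x h0 h1 h2 (by omega),
        swap_apply_of_ne_of_ne (inl_ne_inl_of_val_ne (by simp only []; omega))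
          (inl_ne_inl_of_val_ne (by simp only []; omega)),
        swap_apply_of_ne_of_ne (inl_ne_inl_of_val_ne (by simp only []; omega))
          (inl_ne_inl_of_val_ne (by simp only []; omega))]
  · rw [rho_inr, Perm.mul_apply, swap_apply_of_ne_of_ne Sum.inr_ne_inl Sum.inr_ne_inl,
      swap_apply_of_ne_of_ne Sum.inr_ne_inl Sum.inr_ne_inl]

end Rho

/-! ### Lemma 3.7: the chosen interchange gains exactly two orbits -/

section Lemma37

variable {α : Type*}

/-- **Case (A)** (`i₀, i₂, i₁` on one cycle, `i₂ = α²(i₀)`): `ρ = (0⁺ i₂⁺)(0⁺ i₁⁺)` splits twice. [cite: Heuer2020, Lemma 3.7] -/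
theorem ncyc_swap_swap_mul_alpha_three (q : Perm (Fin n)) {z₀ z₁ z₂ : Fin n} (h01 : z₀.val ≠ z₁.val)
    (h02 : z₀.val ≠ z₂.val) (h12 : z₁.val ≠ z₂.val) (hK : (alpha q).SameCycle (Sum.inl z₀) (Sum.inl z₁))
    (hM : alpha q (alpha q (Sum.inl z₀)) = Sum.inl z₂) :
    ncyc (swap (Sum.inl z₀) (Sum.inl z₂) * swap (Sum.inl z₀) (Sum.inl z₁) * alpha q) = ncyc (alpha q) + 2 := by
  rw [mul_assoc]
  have h1 : ncyc (swap (Sum.inl z₀) (Sum.inl z₁) * alpha q) = ncyc (alpha q) + 1 :=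
    ncyc_swap_mul_of_sameCycle (alpha q) (inl_ne_inl_of_val_ne h01) hK
  have h2 : (swap (Sum.inl z₀) (Sum.inl z₁) * alpha q).SameCycle (Sum.inl z₀) (Sum.inl z₂) := by
    have key := sameCycle_swap_mul_of_arc (f := alpha q) (x := Sum.inl z₀) (y := Sum.inl z₁) (k := 2) ?_
    · rwa [pow_two, Perm.mul_apply, hM] at key
    intro j hj1 hj2
    interval_cases j
    · rw [pow_one, alpha_inl]
      exact ⟨Sum.inr_ne_inl, Sum.inr_ne_inl⟩
    · rw [pow_two, Perm.mul_apply, hM]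
      exact ⟨inl_ne_inl_of_val_ne (Ne.symm h02), inl_ne_inl_of_val_ne (Ne.symm h12)⟩
  rw [ncyc_swap_mul_of_sameCycle _ (inl_ne_inl_of_val_ne h02) h2, h1]

/-- **Case (B)** (`i₀ ~ i₂` and `i₁ ~ i₃` on two distinct cycles): `ρ = (0⁺ i₂⁺)(i₁⁺ i₃⁺)` splits both. [cite: Heuer2020, Lemma 3.7] -/
theorem ncyc_swap_swap_mul_alpha_four (q : Perm (Fin n)) {z₀ z₁ z₂ z₃ : Fin n} (h02 : z₀.val ≠ z₂.val)
    (h13 : z₁.val ≠ z₃.val) (hKL : (alpha q).SameCycle (Sum.inl z₁) (Sum.inl z₃))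
    (h0M : (alpha q).SameCycle (Sum.inl z₀) (Sum.inl z₂)) (hnot : ¬ (alpha q).SameCycle (Sum.inl z₀) (Sum.inl z₁)) :
    ncyc (swap (Sum.inl z₀) (Sum.inl z₂) * swap (Sum.inl z₁) (Sum.inl z₃) * alpha q) = ncyc (alpha q) + 2 := by
  rw [mul_assoc]
  have h1 : ncyc (swap (Sum.inl z₁) (Sum.inl z₃) * alpha q) = ncyc (alpha q) + 1 :=
    ncyc_swap_mul_of_sameCycle (alpha q) (inl_ne_inl_of_val_ne h13) hKL
  have h2 : (swap (Sum.inl z₁) (Sum.inl z₃) * alpha q).SameCycle (Sum.inl z₀) (Sum.inl z₂) :=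
    sameCycle_swap_mul_of_not_sameCycle hnot (fun h => hnot (h.trans hKL.symm)) h0M
  rw [ncyc_swap_mul_of_sameCycle _ (inl_ne_inl_of_val_ne h02) h2, h1]

/-- Splitting an `ofFn` word into four consecutive blocks of prescribed lengths. [folklore] -/
theorem ofFn_eq_append4 (V : Fin n → α) {a b c : ℕ} (habc : a + b + c ≤ n) :
    List.ofFn V = (List.ofFn V).take a ++ ((List.ofFn V).drop a).take b ++ ((List.ofFn V).drop (a + b)).take c ++
      (List.ofFn V).drop (a + b + c) ∧
    ((List.ofFn V).take a).length = a ∧ (((List.ofFn V).drop a).take b).length = b ∧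
    (((List.ofFn V).drop (a + b)).take c).length = c ∧ ((List.ofFn V).drop (a + b + c)).length = n - (a + b + c) := by
  refine ⟨?_, ?_, ?_, ?_, ?_⟩
  · conv_lhs => rw [← List.take_append_drop a (List.ofFn V), ← List.take_append_drop b ((List.ofFn V).drop a),
      List.drop_drop, ← List.take_append_drop c ((List.ofFn V).drop (a + b)), List.drop_drop]
    simp only [List.append_assoc]
  · simp; omega
  · simp; omega
  · simp; omega
  · simp

open Fin.NatCast Fin.CommRing in
/-- **The key step at base point `0`** ([Heuer2020, proof of Claim 3.9]): from the configuration of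
Lemma 3.5 (relabelled so that `i₀ = 0`), the block interchange `v₁ v₂ v₄ ↦ v₁ v₄ v₂` (case (A))
resp. `v₁ v₂ v₃ v₄ ↦ v₁ v₄ v₃ v₂` (case (B)) of `v` carries a matching with two more orbits.
[cite: Heuer2020, Claim 3.9] -/
theorem exists_isBlockInterchange_ncyc_add_two [NeZero n] {V W : Fin n → α} {q : Perm (Fin n)}
    (hq : IsMatching V W q) {K M : ℕ} (hK0 : 0 < K) (hKM : K < M) (hMn : M < n)
    (hτ0 : tauP q 0 = (M : Fin n))
    (hcase : (tauP q).SameCycle 0 (K : Fin n) ∨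
      ∃ L : ℕ, M < L ∧ L < n ∧ tauP q (K : Fin n) = (L : Fin n) ∧ ¬ (tauP q).SameCycle 0 (K : Fin n)) :
    ∃ (U : Fin n → α) (q' : Perm (Fin n)), IsBlockInterchange (List.ofFn V) (List.ofFn U) ∧
      IsMatching U W q' ∧ ncyc (alpha q') = ncyc (alpha q) + 2 := by
  have e0 : ((⟨0, Nat.pos_of_ne_zero (NeZero.ne n)⟩ : Fin n)) = 0 := Fin.ext rfl
  have eK : ((⟨K, by omega⟩ : Fin n)) = (K : Fin n) := Fin.ext (Fin.val_cast_of_lt (by omega)).symm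
  rcases hcase with hA | ⟨L, hML, hLn, hτK, hnot⟩
  · -- case (A): blocks `K, M - K, 0, n - M`
    have hn : n = K + (M - K) + 0 + (n - M) := by omega
    obtain ⟨hv, h₁, h₂, h₃, h₄⟩ := ofFn_eq_append4 V (a := K) (b := M - K) (c := 0) (by omega)
    set w₁ := (List.ofFn V).take K
    set w₂ := ((List.ofFn V).drop K).take (M - K)
    set w₃ := ((List.ofFn V).drop (K + (M - K))).take 0
    set w₄ := (List.ofFn V).drop (K + (M - K) + 0)
    obtain ⟨U, hu⟩ := exists_eq_ofFn (n := n) (u := w₁ ++ w₄ ++ w₃ ++ w₂)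
      (by simp only [List.length_append, h₁, h₂, h₃, h₄]; omega)
    refine ⟨U, q * (blockPerm K (M - K) 0 (n - M) n hn)⁻¹, ⟨w₁, w₂, w₃, w₄, hv, hu.symm⟩,
      hq.transport_blockPerm hn h₁ h₂ h₃ (by rw [h₄]; omega) hv hu.symm, ?_⟩
    rw [ncyc_alpha_transport, rho_blockPerm_three hn hK0 (by omega) (by omega)]
    refine ncyc_swap_swap_mul_alpha_three q (by simp only []; omega) (by simp only []; omega)
      (by simp only []; omega) ?_ ?_
    · rw [sameCycle_inl_iff, e0, eK]
      exact hA
    · rw [alpha_alpha_inl_eq, e0, hτ0, Sum.inl.injEq]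
      exact Fin.ext (by rw [Fin.val_cast_of_lt hMn]; simp only []; omega)
  · -- case (B): blocks `K, M - K, L - M, n - L`
    have hn : n = K + (M - K) + (L - M) + (n - L) := by omega
    obtain ⟨hv, h₁, h₂, h₃, h₄⟩ := ofFn_eq_append4 V (a := K) (b := M - K) (c := L - M) (by omega)
    set w₁ := (List.ofFn V).take K
    set w₂ := ((List.ofFn V).drop K).take (M - K)
    set w₃ := ((List.ofFn V).drop (K + (M - K))).take (L - M)
    set w₄ := (List.ofFn V).drop (K + (M - K) + (L - M))
    obtain ⟨U, hu⟩ := exists_eq_ofFn (n := n) (u := w₁ ++ w₄ ++ w₃ ++ w₂)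
      (by simp only [List.length_append, h₁, h₂, h₃, h₄]; omega)
    refine ⟨U, q * (blockPerm K (M - K) (L - M) (n - L) n hn)⁻¹, ⟨w₁, w₂, w₃, w₄, hv, hu.symm⟩,
      hq.transport_blockPerm hn h₁ h₂ h₃ (by rw [h₄]; omega) hv hu.symm, ?_⟩
    rw [ncyc_alpha_transport, rho_blockPerm_four hn hK0 (by omega) (by omega) (by omega)]
    have eL : ((⟨K + (M - K) + (L - M), by omega⟩ : Fin n)) = (L : Fin n) :=
      Fin.ext (by rw [Fin.val_cast_of_lt hLn]; simp only []; omega)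
    have eM : ((⟨K + (M - K), by omega⟩ : Fin n)) = (M : Fin n) :=
      Fin.ext (by rw [Fin.val_cast_of_lt hMn]; simp only []; omega)
    refine ncyc_swap_swap_mul_alpha_four q (by simp only []; omega) (by simp only []; omega) ?_ ?_ ?_
    · rw [sameCycle_inl_iff, eK, eL]
      exact ⟨1, by rw [zpow_one, hτK]⟩
    · rw [sameCycle_inl_iff, e0, eM]
      exact ⟨1, by rw [zpow_one, hτ0]⟩
    · rw [sameCycle_inl_iff, e0, eK]
      exact hnot

open Fin.NatCast Fin.CommRing in
/-- **The key step** ([Heuer2020, Claim 3.9]: "there is a cyclic block interchange `ṽ` of `v` such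
that `cl(ṽ + w⁻¹) = cl(v + w⁻¹) − 1`", in orbit-counting form): if `α² ≠ 1` for a matching `p` of
`v` against `w`, some cyclic block interchange of `v` carries a matching with exactly two more
orbits. [cite: Heuer2020, Claim 3.9] -/
theorem exists_isCBI_ncyc_add_two {V W : Fin n → α} {p : Perm (Fin n)} (hp : IsMatching V W p)
    (h2 : alpha p ^ 2 ≠ 1) :
    ∃ (U : Fin n → α) (q : Perm (Fin n)), IsCBI (List.ofFn V) (List.ofFn U) ∧ IsMatching U W q ∧
      ncyc (alpha q) = ncyc (alpha p) + 2 := by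
  rcases Nat.eq_zero_or_pos n with hn0 | hn0
  · subst hn0
    exact absurd (Subsingleton.elim _ _) h2
  haveI : NeZero n := ⟨by omega⟩
  have hτ : tauP p ≠ 1 := fun h => h2 ((tauP_eq_one_iff p).1 h)
  obtain ⟨x₀, K, M, hK0, hKM, hMn, hτx₀, hcase⟩ := exists_config p hτ
  set R := finRotate n ^ x₀.val with hRdef
  have hR : ∀ z : Fin n, R z = z + x₀ := fun z => by rw [hRdef, finRotate_pow_apply, Fin.cast_val_eq_self]
  have hRinv : ∀ z : Fin n, R⁻¹ z = z - x₀ := fun z => by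
    rw [Perm.inv_def, Equiv.symm_apply_eq, hR, sub_add_cancel]
  have hq : IsMatching (V ∘ R) W (p * R) := fun i => by rw [Perm.mul_apply, hp, Function.comp_apply]
  have hτ' : ∀ z, tauP (p * R) z = tauP p (z + x₀) - x₀ := fun z => by
    rw [hRdef, tauP_mul_pow, ← hRdef, Perm.mul_apply, Perm.mul_apply, hR, hRinv]
  have hsc : ∀ y z, (tauP (p * R)).SameCycle y z ↔ (tauP p).SameCycle (y + x₀) (z + x₀) := fun y z => by
    rw [hRdef, tauP_mul_pow, ← hRdef, show R⁻¹ * tauP p * R = R⁻¹ * tauP p * (R⁻¹)⁻¹ by rw [inv_inv],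
      sameCycle_conj, inv_inv, hR, hR]
  have hτ0 : tauP (p * R) 0 = (M : Fin n) := by rw [hτ', zero_add, hτx₀]; ring
  have hcase' : (tauP (p * R)).SameCycle 0 (K : Fin n) ∨
      ∃ L : ℕ, M < L ∧ L < n ∧ tauP (p * R) (K : Fin n) = (L : Fin n) ∧ ¬ (tauP (p * R)).SameCycle 0 (K : Fin n) := by
    rcases hcase with hA | ⟨L, hML, hLn, hτK, hnot⟩
    · left
      rw [hsc, zero_add, add_comm]
      exact hA
    · right
      refine ⟨L, hML, hLn, ?_, ?_⟩
      · rw [hτ', add_comm, hτK]; ring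
      · rw [hsc, zero_add, add_comm]
        exact hnot
  obtain ⟨U, q', hbi, hq', hnc⟩ := exists_isBlockInterchange_ncyc_add_two hq hK0 hKM hMn hτ0 hcase'
  refine ⟨U, q', ⟨List.ofFn (V ∘ R), List.ofFn U, ?_, List.IsRotated.refl _, hbi⟩, hq', ?_⟩
  · rw [hRdef, ofFn_comp_finRotate_pow']
    exact List.IsRotated.forall _ _
  · rw [hnc, show p * R = p * (R⁻¹)⁻¹ by rw [inv_inv], ncyc_alpha_transport_of_comm p (pow_finRotate_inv_comm _)]

end Lemma37

/-! ### The orbit-counting formula for the cyclic block interchange distance -/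

section Formula

variable {α : Type*}

/-- **`2 d_cbi(v, w) + orb(σπ) ≤ n` for every matching** — the upper bound for `d_cbi` by
induction on `n − orb` ([Heuer2020, proof of Thm. 2 (i)]: "by applying Claim 3.9 multiple times we
obtain a sequence `z⁰, …, zᵏ` with `k = cl(v + w⁻¹)`"). [cite: Heuer2020, Thm. 2 (i)] -/
theorem two_mul_dcbi_add_ncyc_le {V W : Fin n → α} {p : Perm (Fin n)} (hp : IsMatching V W p) :
    2 * dcbi (List.ofFn V) (List.ofFn W) + ncyc (alpha p) ≤ n := by
  induction h : n - ncyc (alpha p) using Nat.strong_induction_on generalizing V p with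
  | _ m ih =>
    by_cases h2 : alpha p ^ 2 = 1
    · have hc : ncyc (alpha p) = n := (ncyc_alpha_eq_iff p).2 h2
      have h0 : dcbi (List.ofFn V) (List.ofFn W) = 0 := (dcbi_ofFn_eq_zero_iff hp.perm).2 ⟨p, hp, hc⟩
      omega
    · obtain ⟨U, q, hcbi, hq, hnc⟩ := exists_isCBI_ncyc_add_two hp h2
      have hle := ncyc_alpha_le q
      have ih' := ih (n - ncyc (alpha q)) (by omega) hq rfl
      have hstep := dcbi_le_dcbi_add_one hcbi hq.perm
      omega

/-- **The orbit-counting formula for the cyclic block interchange distance**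
([Heuer2020, Thm. 2 (i)] in the language of letter matchings; loc. cit. identifies the right-hand
side with `2 cl(v + w⁻¹)` by Bardakov's theorem for the chain `v + w⁻¹`): for related words of
length `n` there is a matching `π` of `v` against `w` maximising `orb(σπ)`, and
`2 d_cbi(v, w) = n − orb(σπ)`. [cite: Heuer2020, Thm. 2 (i)] -/
theorem two_mul_dcbi_eq {V W : Fin n → α} (h : List.Perm (List.ofFn V) (List.ofFn W)) :
    ∃ p, IsMatching V W p ∧ 2 * dcbi (List.ofFn V) (List.ofFn W) + ncyc (alpha p) = n ∧
      ∀ q, IsMatching V W q → ncyc (alpha q) ≤ ncyc (alpha p) := by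
  obtain ⟨p, hp, hle⟩ := exists_isMatching_le_ncyc_add h
  have hge := two_mul_dcbi_add_ncyc_le hp
  refine ⟨p, hp, by omega, fun q hq => ?_⟩
  have := two_mul_dcbi_add_ncyc_le hq
  omega

/-- **`d_cbi(v,w) ≤ k` iff some matching has `n ≤ orb(σπ) + 2k`** (related words): the form in
which the distance is decided from orbit counts. [cite: Heuer2020, Thm. 2 (i)] -/
theorem dcbi_le_iff_exists_isMatching {V W : Fin n → α} (h : List.Perm (List.ofFn V) (List.ofFn W)) (k : ℕ) :
    dcbi (List.ofFn V) (List.ofFn W) ≤ k ↔ ∃ p, IsMatching V W p ∧ n ≤ ncyc (alpha p) + 2 * k := by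
  constructor
  · intro hk
    obtain ⟨p, hp, he, -⟩ := two_mul_dcbi_eq h
    exact ⟨p, hp, by omega⟩
  · rintro ⟨p, hp, hle⟩
    have := two_mul_dcbi_add_ncyc_le hp
    omega

end Formula

end CBI

end Literature.GroupTheory.CombinatorialGroupTheory
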